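import Summits.RiemannHypothesis.RiemannHypothesis.Theses.GroundBarta
import Summits.RiemannHypothesis.RiemannHypothesis.Theorems.GroundBartaPolarPerronFrobeniusParitySign
import Summits.RiemannHypothesis.RiemannHypothesis.Theorems.GroundBartaPolarPerronFrobeniusEvenSmallWindows
import Summits.RiemannHypothesis.RiemannHypothesis.Theorems.OddSectorOddOneSignedWindowsGoodWindowsClosed
import Summits.RiemannHypothesis.RiemannHypothesis.Theorems.WeilGroundStateMarkovPartPositiveGroundStateDensity
import Literature.NumberTheory.LFunctions.WeilWindowSuzukiContinuityProofs
import Literature.NumberTheory.LFunctions.WeilSemilocalCompactnessProofs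
import HarnessLib

/-!
# RiemannHypothesis / GroundBarta — crux `PolarPerronFrobenius` (stmt-RiemannHypothesis-18390):
# the set of windows carrying a one-signed ground state is CLOSED; last good window off RH

Helper file (`--supports stmt-RiemannHypothesis-18390`), RH-free, Mathlib + landed tree files only, no
definitions, no named facts.  Call a window `a > 0` GOOD (`GSP a`) when the FULL windowed Weil form at
`a` has a ground state (`IsWeilGroundState a u`) that is real and `≥ 0` a.e. on `(-a, a)` — the
conclusion of the crux's matrix.  Known: `(0, 1/4] ⊆ G` (`swe_exists_nonneg_isWeilGroundState`,
RH-free small-window Perron–Frobenius), `G` unbounded `→ RH` (`riemannHypothesis_of_cofinal_oneSigned`,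
floor + detector, both PROVED).  This file is the parity-free twin of the odd-sector theorem
`OddSector.goodWindows_seqClosed` (crux `OddOneSignedWindows`, 2001 Cor. 10.4 "first failure by
touchdown"):

* `gsp_seqClosed`, `gsp_of_mem_closure` — **`G` is (sequentially) closed in `(0, ∞)`**: if `aₙ → a₀ > 0`
  and every `aₙ` is good, so is `a₀`.  Proof as in the odd sector, parity dropped: one-signed ground
  states `uₙ` at `aₙ`, window tests `Gₙ` with `‖Gₙ − uₙ‖₂² ≤ 1/(n+1)`, `|Re Q(Gₙ) − ε(aₙ)| ≤ 1/(n+1)`, all on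
  the window `2a₀` with energies `≤ ε(a₀/2) + 1` (antitonicity); a subsequence converges in `L²` to some
  `w` (Connes–Consani–Moscovici 2025 Thm 3.6, PROVED); `Re Q(G_{φ n}) → ε(a₀)` by CONTINUITY of `ε`
  (Suzuki 2026 Thm 1.3, `continuousAt_weilGroundEnergy`, PROVED); the dilates `(G_{φ n})_{ηₙ}`,
  `1 + ηₙ = max(1, a_{φ n}/a₀) → 1`, are normalised tests on the window `a₀` with the same energy limit
  (uniform dilation modulus `exists_weilDilate_modulus`) and the same `L²` limit (strong continuity of
  dilation on tests), so `w` is a ground state at `a₀`; and `u_{φ n} → w` in `L²`, each `u_{φ n}` one-signed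
  on `(-a', a') ⊆ (-a_{φ n}, a_{φ n})` for `a' < a₀` eventually, so `w` is one-signed on `(-a₀, a₀)`.
* `exists_lastGoodWindow_of_not_riemannHypothesis` — **if RH fails there is a LAST good window**
  `a⋆ ≥ 1/4`: `GSP a⋆` and `¬ GSP a` for every `a > a⋆` (`G` is nonempty, bounded off RH by
  `eventually_not_oneSigned_of_not_riemannHypothesis`, and closed, so `sup G ∈ G`).  Perron–Frobenius for
  the windowed Weil form, if it ever dies, dies by TOUCHDOWN at a finite height and never recovers.
* `riemannHypothesis_or_lastGoodWindow` — the dichotomy form; `riemannHypothesis_of_goodWindows_dense`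
  — `G ⊇` a set with unbounded closure already gives RH.

Prover B, speedrun unit `sr-gb-rung-b` (seat 3).  References: E. Bombieri, Rend. Lincei (9) 11 (2000) §4
Thm 3, Thm 5; A. Connes, C. Consani, H. Moscovici, arXiv:2511.22755 Thm 3.6; M. Suzuki, arXiv:2606.09096
Thm 1.3.
-/

set_option linter.dupNamespace false

noncomputable section

open MeasureTheory Complex Filter Set
open scoped Real Topology

namespace Summit.RiemannHypothesis.RiemannHypothesis.Theorems.PolarPerronFrobenius

open Literature.NumberTheory.LFunctions
open Summit.RiemannHypothesis.RiemannHypothesis.Theses.GroundBarta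
open Summit.RiemannHypothesis.RiemannHypothesis.Theorems.OddSector
  (min_re_sq_add_im_sq_le tendsto_integral_norm_sq_weilDilate_sub weilDilate_sub div_one_add_max_le)
open Summit.RiemannHypothesis.RiemannHypothesis.Theorems.WeilGroundStateMarkovPart (integral_norm_sq_add_le)

/-! ### One-signedness on a set passes to `L²` limits -/

/-- **One-signedness passes to `L²` limits (on a measurable set).** If `fₙ → w` in `L²` and every `fₙ`
is real and `≥ 0` a.e. on the measurable set `S`, then so is `w` (the squared distance of `w(t)` to the
cone `[0, ∞) ⊆ ℂ` is dominated by `|fₙ(t) − w(t)|²`, whose integral tends to `0`).  Set-generic form of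
`OddSector.ae_sign_of_tendsto_ae`. [folklore] -/
theorem ae_sign_on_of_tendsto {f : ℕ → ℝ → ℂ} {w : ℝ → ℂ} {S : Set ℝ} (hS : MeasurableSet S)
    (hfm : ∀ n, MemLp (f n) 2) (hw : MemLp w 2)
    (hsign : ∀ n, ∀ᵐ t : ℝ, t ∈ S → (f n t).im = 0 ∧ 0 ≤ (f n t).re)
    (hlim : Tendsto (fun n ↦ ∫ t, ‖f n t - w t‖ ^ 2) atTop (𝓝 0)) :
    ∀ᵐ t : ℝ, t ∈ S → (w t).im = 0 ∧ 0 ≤ (w t).re := by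
  -- adapted from `OddSector.ae_sign_of_tendsto_ae` (Theorems/OddSectorOddOneSignedWindowsGoodWindowsClosed.lean)
  set D : ℝ → ℝ := S.indicator fun t ↦ (min (w t).re 0) ^ 2 + (w t).im ^ 2 with hD
  have hDnn : ∀ t, 0 ≤ D t := fun t ↦ by
    simp only [hD]
    exact Set.indicator_nonneg (fun _ _ ↦ by positivity) _
  have hDle : ∀ n, ∀ᵐ t : ℝ, D t ≤ ‖f n t - w t‖ ^ 2 := fun n ↦ by
    filter_upwards [hsign n] with t ht
    by_cases hta : t ∈ S
    · simp only [hD, Set.indicator_of_mem hta]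
      exact min_re_sq_add_im_sq_le (ht hta)
    · simp only [hD, Set.indicator_of_notMem hta]
      positivity
  have hsub : ∀ n, Integrable fun t ↦ ‖f n t - w t‖ ^ 2 := fun n ↦
    (memLp_two_iff_integrable_sq_norm ((hfm n).sub hw).1).1 ((hfm n).sub hw)
  have hI : ∀ n, ∫ t, D t ≤ ∫ t, ‖f n t - w t‖ ^ 2 := fun n ↦
    integral_mono_of_nonneg (Eventually.of_forall hDnn) (hsub n) (hDle n)
  have hI0 : ∫ t, D t = 0 :=
    le_antisymm (ge_of_tendsto' hlim hI) (integral_nonneg hDnn)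
  have hDm : AEStronglyMeasurable D volume := by
    have hre : AEMeasurable (fun t ↦ (w t).re) volume :=
      Complex.measurable_re.comp_aemeasurable hw.1.aemeasurable
    have him : AEMeasurable (fun t ↦ (w t).im) volume :=
      Complex.measurable_im.comp_aemeasurable hw.1.aemeasurable
    exact (((hre.min aemeasurable_const).pow_const 2).add (him.pow_const 2)).indicator
      hS |>.aestronglyMeasurable
  have hDint : Integrable D :=
    Integrable.mono' (hsub 0) hDm (by
      filter_upwards [hDle 0] with t ht
      rw [Real.norm_of_nonneg (hDnn t)]; exact ht)
  have hae : D =ᵐ[volume] 0 := (integral_eq_zero_iff_of_nonneg hDnn hDint).1 hI0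
  filter_upwards [hae] with t ht hta
  have h0 : (min (w t).re 0) ^ 2 + (w t).im ^ 2 = 0 := by
    simpa [hD, Set.indicator_of_mem hta] using ht
  have h1 : (min (w t).re 0) ^ 2 = 0 := by nlinarith [sq_nonneg (min (w t).re 0), sq_nonneg (w t).im]
  have h2 : (w t).im ^ 2 = 0 := by nlinarith [sq_nonneg (min (w t).re 0), sq_nonneg (w t).im]
  refine ⟨pow_eq_zero_iff (n := 2) two_ne_zero |>.1 h2, ?_⟩
  have h3 : min (w t).re 0 = 0 := pow_eq_zero_iff (n := 2) two_ne_zero |>.1 h1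
  exact min_eq_right_iff.1 h3

/-! ### Closedness of the good-window set of the full form -/

/-- **The set of windows carrying a one-signed ground state of the FULL windowed Weil form is
sequentially closed in `(0, ∞)`.**  If `bₙ → a₀ > 0` and every window `bₙ` carries a ground state that
is real and `≥ 0` a.e. on `(-bₙ, bₙ)`, then so does `a₀` (proof in the module docstring; parity-free twin
of `OddSector.goodWindows_seqClosed`). [folklore] -/
theorem gsp_seqClosed :
    ∀ (a₀ : ℝ) (b : ℕ → ℝ), 0 < a₀ → Tendsto b atTop (𝓝 a₀) →
      (∀ n, ∃ u : ℝ → ℂ, IsWeilGroundState (b n) u ∧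
        ∀ᵐ t : ℝ, t ∈ Ioo (-(b n)) (b n) → (u t).im = 0 ∧ 0 ≤ (u t).re) →
      ∃ u : ℝ → ℂ, IsWeilGroundState a₀ u ∧
        ∀ᵐ t : ℝ, t ∈ Ioo (-a₀) a₀ → (u t).im = 0 ∧ 0 ≤ (u t).re := by
  -- adapted from `OddSector.goodWindows_seqClosed` (parity constraint dropped, window `(-a, a)`)
  intro a₀ b ha₀ hb hgood
  -- (0) shift the index so that `a₀/2 < b n < 3a₀/2` for all `n`
  obtain ⟨n₀, hn₀⟩ : ∃ n₀, ∀ n ≥ n₀, |b n - a₀| < a₀ / 2 := by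
    have := (Metric.tendsto_atTop.1 hb) (a₀ / 2) (half_pos ha₀)
    simpa [Real.dist_eq] using this
  set b' : ℕ → ℝ := fun n ↦ b (n + n₀) with hb'def
  have hb' : Tendsto b' atTop (𝓝 a₀) := hb.comp (tendsto_add_atTop_nat n₀)
  have hbwin : ∀ n, a₀ / 2 < b' n ∧ b' n < 3 * a₀ / 2 := fun n ↦ by
    have := hn₀ (n + n₀) (Nat.le_add_left _ _)
    rw [abs_lt] at this
    constructor <;> simp only [hb'def] <;> linarith [this.1, this.2]
  have hbpos : ∀ n, 0 < b' n := fun n ↦ by linarith [(hbwin n).1]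
  -- (1) one-signed ground states and nearby window tests
  choose u hu hsign using fun n ↦ hgood (n + n₀)
  have hG : ∀ n, ∃ G : ℝ → ℂ, (IsWeilTest G ∧ tsupport G ⊆ Icc (-(b' n)) (b' n) ∧
      ∫ t, ‖G t‖ ^ 2 = (1 : ℝ)) ∧
      ∫ t, ‖G t - u n t‖ ^ 2 < 1 / ((n : ℝ) + 1) ∧
      |(weilQuadratic G).re - weilGroundEnergy (b' n)| < 1 / ((n : ℝ) + 1) := by
    intro n
    obtain ⟨-, g, hg, hQ, hL⟩ := hu n
    have hpos : (0 : ℝ) < 1 / ((n : ℝ) + 1) := by positivity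
    have h1 : ∀ᶠ k in atTop, ∫ t, ‖g k t - u n t‖ ^ 2 < 1 / ((n : ℝ) + 1) :=
      hL.eventually (eventually_lt_nhds hpos)
    have h2 : ∀ᶠ k in atTop, |(weilQuadratic (g k)).re - weilGroundEnergy (b' n)| <
        1 / ((n : ℝ) + 1) := by
      have := (Metric.tendsto_nhds.1 hQ) _ hpos
      simpa only [Real.dist_eq] using this
    obtain ⟨k, hk1, hk2⟩ := (h1.and h2).exists
    exact ⟨g k, hg k, hk1, hk2⟩
  choose G hGt hGu hGQ using hG
  have hGm : ∀ n, MemLp (G n) 2 := fun n ↦ (hGt n).1.memLp_two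
  have hum : ∀ n, MemLp (u n) 2 := fun n ↦ (hu n).memLp
  -- all `G n` live on the window `2a₀`, with bounded energies
  have hG2 : ∀ n, IsWeilTest (G n) ∧ tsupport (G n) ⊆ Icc (-(2 * a₀)) (2 * a₀) ∧
      ∫ t, ‖G n t‖ ^ 2 = (1 : ℝ) := fun n ↦
    ⟨(hGt n).1, (hGt n).2.1.trans (Icc_subset_Icc (by linarith [(hbwin n).2])
      (by linarith [(hbwin n).2])), (hGt n).2.2⟩
  set E : ℝ := weilGroundEnergy (a₀ / 2) + 1 with hEdef
  have hGE : ∀ n, (weilQuadratic (G n)).re ≤ E := fun n ↦ by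
    have h1 : weilGroundEnergy (b' n) ≤ weilGroundEnergy (a₀ / 2) :=
      weilGroundEnergy_anti (half_pos ha₀) (hbwin n).1.le
    have h2 := (abs_lt.1 (hGQ n)).2
    have h3 : 1 / ((n : ℝ) + 1) ≤ 1 := by
      rw [div_le_one (by positivity)]; linarith [n.cast_nonneg (α := ℝ)]
    linarith
  -- (2) compactness
  obtain ⟨w, hw, φ, hφ, hconv⟩ := ConnesConsaniMoscovici2025_thm_3_6_holds (2 * a₀) (by positivity)
    G hG2 ⟨E, by rintro _ ⟨n, rfl⟩; exact hGE n⟩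
  -- (3) `ε(b'(φ n)) → ε(a₀)` and `Re Q(G (φ n)) → ε(a₀)`
  have hεlim : Tendsto (fun n ↦ weilGroundEnergy (b' (φ n))) atTop (𝓝 (weilGroundEnergy a₀)) :=
    (continuousAt_weilGroundEnergy ha₀).tendsto.comp (hb'.comp hφ.tendsto_atTop)
  have hinv : Tendsto (fun n ↦ 1 / ((φ n : ℝ) + 1)) atTop (𝓝 0) :=
    tendsto_one_div_add_atTop_nhds_zero_nat.comp hφ.tendsto_atTop
  have hQG : Tendsto (fun n ↦ (weilQuadratic (G (φ n))).re) atTop (𝓝 (weilGroundEnergy a₀)) := by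
    have hdiff : Tendsto (fun n ↦ (weilQuadratic (G (φ n))).re - weilGroundEnergy (b' (φ n)))
        atTop (𝓝 0) :=
      squeeze_zero_norm (fun n ↦ (Real.norm_eq_abs _).trans_le (hGQ (φ n)).le) hinv
    simpa using hdiff.add hεlim
  -- (4) `u (φ n) → w` in `L²`, hence the sign of `w` on `(-a₀, a₀)`
  have huw : Tendsto (fun n ↦ ∫ t, ‖u (φ n) t - w t‖ ^ 2) atTop (𝓝 0) := by
    have hbnd : ∀ n, ∫ t, ‖u (φ n) t - w t‖ ^ 2 ≤
        (2 * ∫ t, ‖G (φ n) t - u (φ n) t‖ ^ 2) + 2 * ∫ t, ‖G (φ n) t - w t‖ ^ 2 := by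
      intro n
      have h := integral_norm_sq_add_le (((hGm (φ n)).sub (hum (φ n))).neg) ((hGm (φ n)).sub hw)
      have e : (fun x ↦ ‖(-((G (φ n)) - u (φ n))) x + (G (φ n) - w) x‖ ^ 2) =
          fun x ↦ ‖u (φ n) x - w x‖ ^ 2 := by funext x; simp only [Pi.neg_apply, Pi.sub_apply]; ring_nf
      have e2 : ∫ x, ‖(-((G (φ n)) - u (φ n))) x‖ ^ 2 = ∫ x, ‖G (φ n) x - u (φ n) x‖ ^ 2 :=
        integral_congr_ae (Eventually.of_forall fun x ↦ by
          simp only [Pi.neg_apply, Pi.sub_apply, norm_neg])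
      rw [e, e2] at h
      simpa only [Pi.sub_apply] using h
    refine squeeze_zero (fun n ↦ integral_nonneg fun _ ↦ by positivity) hbnd ?_
    have h1 : Tendsto (fun n ↦ ∫ t, ‖G (φ n) t - u (φ n) t‖ ^ 2) atTop (𝓝 0) :=
      squeeze_zero (fun n ↦ integral_nonneg fun _ ↦ by positivity) (fun n ↦ (hGu (φ n)).le) hinv
    simpa using (h1.const_mul 2).add (hconv.const_mul 2)
  have hwsign : ∀ᵐ t : ℝ, t ∈ Ioo (-a₀) a₀ → (w t).im = 0 ∧ 0 ≤ (w t).re := by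
    -- on every `(-(a₀ − 1/(k+1)), a₀ − 1/(k+1))`, then exhaust
    have hk : ∀ k : ℕ, ∀ᵐ t : ℝ, t ∈ Ioo (-(a₀ - 1 / ((k : ℝ) + 1))) (a₀ - 1 / ((k : ℝ) + 1)) →
        (w t).im = 0 ∧ 0 ≤ (w t).re := by
      intro k
      set a' : ℝ := a₀ - 1 / ((k : ℝ) + 1) with ha'
      -- eventually `a' < b' (φ n)`
      obtain ⟨N, hN⟩ : ∃ N, ∀ n ≥ N, a' < b' (φ n) := by
        have hlt : a' < a₀ := by rw [ha']; linarith [(by positivity : (0 : ℝ) < 1 / ((k : ℝ) + 1))]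
        exact eventually_atTop.1 ((hb'.comp hφ.tendsto_atTop).eventually (eventually_gt_nhds hlt))
      have hs : ∀ n, ∀ᵐ t : ℝ, t ∈ Ioo (-a') a' →
          (u (φ (n + N)) t).im = 0 ∧ 0 ≤ (u (φ (n + N)) t).re := fun n ↦ by
        filter_upwards [hsign (φ (n + N))] with t ht hta
        have hlt := hN _ (Nat.le_add_left N n)
        exact ht ⟨by linarith [hta.1], hta.2.trans hlt⟩
      exact ae_sign_on_of_tendsto measurableSet_Ioo (fun n ↦ hum (φ (n + N))) hw hs
        (huw.comp (tendsto_add_atTop_nat N))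
    rw [← ae_all_iff] at hk
    filter_upwards [hk] with t ht hta
    obtain ⟨k, hk'⟩ := exists_nat_one_div_lt (by
      have h1 := hta.1; have h2 := hta.2
      show 0 < a₀ - |t|
      rcases le_or_gt 0 t with h | h
      · rw [abs_of_nonneg h]; linarith
      · rw [abs_of_neg h]; linarith)
    refine ht k ⟨?_, ?_⟩
    · have := neg_abs_le t; linarith
    · have := le_abs_self t; linarith
  -- (5) dilate `G (φ n)` onto the window `a₀`
  set η : ℕ → ℝ := fun n ↦ max 0 (b' (φ n) / a₀ - 1) with hηdef
  have hη0 : ∀ n, 0 ≤ η n := fun n ↦ le_max_left _ _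
  have hη1 : ∀ n, η n ≤ 1 := fun n ↦ max_le zero_le_one (by
    have := (hbwin (φ n)).2
    rw [sub_le_iff_le_add, div_le_iff₀ ha₀]; linarith)
  have hηm1 : ∀ n, -1 < η n := fun n ↦ by linarith [hη0 n]
  have hηlim : Tendsto η atTop (𝓝 0) := by
    have h1 : Tendsto (fun n ↦ b' (φ n) / a₀ - 1) atTop (𝓝 (a₀ / a₀ - 1)) :=
      ((hb'.comp hφ.tendsto_atTop).div_const a₀).sub_const 1
    rw [div_self ha₀.ne', sub_self] at h1
    have h2 := (tendsto_const_nhds (x := (0 : ℝ))).max h1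
    simpa [hηdef] using h2
  set H : ℕ → ℝ → ℂ := fun n ↦ weilDilate (η n) (G (φ n)) with hHdef
  have hHt : ∀ n, IsWeilTest (H n) := fun n ↦ (hGt (φ n)).1.weilDilate (hηm1 n)
  have hHs : ∀ n, tsupport (H n) ⊆ Icc (-a₀) a₀ := fun n ↦ by
    have h1 := tsupport_weilDilate_subset (G (φ n)) (hηm1 n) (hGt (φ n)).2.1
    have h2 : b' (φ n) / (1 + η n) ≤ a₀ := div_one_add_max_le ha₀ (hbpos _)
    exact h1.trans (Icc_subset_Icc (by linarith) h2)
  have hHn : ∀ n, ∫ t, ‖H n t‖ ^ 2 = 1 := fun n ↦ by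
    simp only [hHdef]; rw [integral_norm_sq_weilDilate _ (hηm1 n), (hGt (φ n)).2.2]
  -- `Re Q(H n) → ε(a₀)` (uniform dilation modulus on the window `2a₀`)
  have hQH : Tendsto (fun n ↦ (weilQuadratic (H n)).re) atTop (𝓝 (weilGroundEnergy a₀)) := by
    rw [Metric.tendsto_atTop]
    intro ε hε
    obtain ⟨δ, hδ, -, hmod⟩ := exists_weilDilate_modulus (a := 2 * a₀) (by positivity) E (half_pos hε)
    obtain ⟨N₁, hN₁⟩ := (Metric.tendsto_atTop.1 hQG) (ε / 2) (half_pos hε)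
    obtain ⟨N₂, hN₂⟩ : ∃ N₂, ∀ n ≥ N₂, |η n| ≤ δ := by
      obtain ⟨N, hN⟩ := (Metric.tendsto_atTop.1 hηlim) δ hδ
      exact ⟨N, fun n hn ↦ by simpa [Real.dist_eq] using (hN n hn).le⟩
    refine ⟨max N₁ N₂, fun n hn ↦ ?_⟩
    have h1 := hmod (η n) (hN₂ n (le_of_max_le_right hn)) (G (φ n)) (hG2 (φ n)).1 (hG2 (φ n)).2.1
      (hG2 (φ n)).2.2 (hGE (φ n))
    have h2 := hN₁ n (le_of_max_le_left hn)
    rw [Real.dist_eq] at h2 ⊢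
    calc |(weilQuadratic (H n)).re - weilGroundEnergy a₀|
        ≤ |(weilQuadratic (H n)).re - (weilQuadratic (G (φ n))).re| +
            |(weilQuadratic (G (φ n))).re - weilGroundEnergy a₀| := abs_sub_le _ _ _
      _ < ε / 2 + ε / 2 := add_lt_add_of_le_of_lt h1 h2
      _ = ε := by ring
  -- `H n → w` in `L²`
  have hHL : Tendsto (fun n ↦ ∫ t, ‖H n t - w t‖ ^ 2) atTop (𝓝 0) := by
    -- the three-epsilon bound through a fixed `G (φ m)`
    have hbnd : ∀ n m, ∫ t, ‖H n t - w t‖ ^ 2 ≤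
        (4 * ∫ t, ‖G (φ n) t - w t‖ ^ 2) + (8 * ∫ t, ‖G (φ m) t - w t‖ ^ 2) +
          4 * ∫ t, ‖weilDilate (η n) (G (φ m)) t - G (φ m) t‖ ^ 2 := by
      intro n m
      have hDm' : MemLp (weilDilate (η n) (G (φ m))) 2 :=
        ((hGt (φ m)).1.weilDilate (hηm1 n)).memLp_two
      have hHm : MemLp (H n) 2 := (hHt n).memLp_two
      have s1 := integral_norm_sq_add_le (hHm.sub hDm') (hDm'.sub hw)
      have e1 : (fun x ↦ ‖(H n - weilDilate (η n) (G (φ m))) x + (weilDilate (η n) (G (φ m)) - w) x‖ ^ 2)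
          = fun x ↦ ‖H n x - w x‖ ^ 2 := by
        funext x; simp only [Pi.sub_apply, sub_add_sub_cancel]
      rw [e1] at s1
      have e2 : ∫ x, ‖(H n - weilDilate (η n) (G (φ m))) x‖ ^ 2 =
          ∫ x, ‖G (φ n) x - G (φ m) x‖ ^ 2 := by
        have : (H n - weilDilate (η n) (G (φ m))) =
            weilDilate (η n) (fun t ↦ G (φ n) t - G (φ m) t) := by
          rw [weilDilate_sub]; rfl
        rw [this, integral_norm_sq_weilDilate _ (hηm1 n)]
      rw [e2] at s1
      have s2 := integral_norm_sq_add_le ((hGm (φ n)).sub hw) ((hGm (φ m)).sub hw).neg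
      have e3 : (fun x ↦ ‖(G (φ n) - w) x + (-(G (φ m) - w)) x‖ ^ 2) =
          fun x ↦ ‖G (φ n) x - G (φ m) x‖ ^ 2 := by
        funext x; simp only [Pi.sub_apply, Pi.neg_apply]; ring_nf
      have e4 : ∫ x, ‖(-(G (φ m) - w)) x‖ ^ 2 = ∫ x, ‖G (φ m) x - w x‖ ^ 2 :=
        integral_congr_ae (Eventually.of_forall fun x ↦ by simp only [Pi.neg_apply, Pi.sub_apply, norm_neg])
      rw [e3, e4] at s2
      have s3 := integral_norm_sq_add_le (hDm'.sub (hGm (φ m))) ((hGm (φ m)).sub hw)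
      have e5 : (fun x ↦ ‖(weilDilate (η n) (G (φ m)) - G (φ m)) x + (G (φ m) - w) x‖ ^ 2) =
          fun x ↦ ‖(weilDilate (η n) (G (φ m)) - w) x‖ ^ 2 := by
        funext x; simp only [Pi.sub_apply, sub_add_sub_cancel]
      rw [e5] at s3
      simp only [Pi.sub_apply] at s1 s2 s3 ⊢
      linarith
    rw [Metric.tendsto_atTop]
    intro ε hε
    obtain ⟨m, hm⟩ : ∃ m, ∫ t, ‖G (φ m) t - w t‖ ^ 2 < ε / 24 :=
      ((Metric.tendsto_atTop.1 hconv) (ε / 24) (by positivity)).imp fun m h ↦ by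
        have := h m le_rfl
        rw [Real.dist_eq, sub_zero, abs_of_nonneg (integral_nonneg fun _ ↦ by positivity)] at this
        exact this
    have hDil := tendsto_integral_norm_sq_weilDilate_sub (hGt (φ m)).1 hη0 hη1 hηlim
    obtain ⟨N₁, hN₁⟩ := (Metric.tendsto_atTop.1 hconv) (ε / 12) (by positivity)
    obtain ⟨N₂, hN₂⟩ := (Metric.tendsto_atTop.1 hDil) (ε / 12) (by positivity)
    refine ⟨max N₁ N₂, fun n hn ↦ ?_⟩
    have h1 := hN₁ n (le_of_max_le_left hn)
    have h2 := hN₂ n (le_of_max_le_right hn)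
    rw [Real.dist_eq, sub_zero, abs_of_nonneg (integral_nonneg fun _ ↦ by positivity)] at h1 h2 ⊢
    linarith [hbnd n m]
  -- (6) assemble
  exact ⟨w, ⟨hw, H, fun n ↦ ⟨hHt n, hHs n, hHn n⟩, hQH, hHL⟩, hwsign⟩

/-- **Closedness, set form**: the closure within `(0, ∞)` of the set of good windows of the full form
consists of good windows. [folklore] -/
theorem gsp_of_mem_closure {a₀ : ℝ} (ha₀ : 0 < a₀)
    (h : a₀ ∈ closure {a : ℝ | ∃ u : ℝ → ℂ, IsWeilGroundState a u ∧
      ∀ᵐ t : ℝ, t ∈ Ioo (-a) a → (u t).im = 0 ∧ 0 ≤ (u t).re}) :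
    ∃ u : ℝ → ℂ, IsWeilGroundState a₀ u ∧
      ∀ᵐ t : ℝ, t ∈ Ioo (-a₀) a₀ → (u t).im = 0 ∧ 0 ≤ (u t).re := by
  obtain ⟨b, hbmem, hb⟩ := mem_closure_iff_seq_limit.1 h
  exact gsp_seqClosed a₀ b ha₀ hb hbmem

/-! ### Off RH: a last good window, by touchdown -/

/-- **RH from a set of good windows with unbounded closure** (e.g. a dense subset of a ray): closedness
upgrades `riemannHypothesis_of_cofinal_oneSigned`. [folklore] -/
theorem riemannHypothesis_of_goodWindows_closure_unbounded
    (h : ∀ A : ℝ, ∃ a : ℝ, A ≤ a ∧ a ∈ closure {a : ℝ | ∃ u : ℝ → ℂ, IsWeilGroundState a u ∧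
      ∀ᵐ t : ℝ, t ∈ Ioo (-a) a → (u t).im = 0 ∧ 0 ≤ (u t).re}) :
    RiemannHypothesis := by
  refine riemannHypothesis_of_cofinal_oneSigned fun A ↦ ?_
  obtain ⟨a, ha, hmem⟩ := h (max A 1)
  have ha0 : 0 < a := lt_of_lt_of_le one_pos ((le_max_right A 1).trans ha)
  exact ⟨a, (le_max_left A 1).trans ha, gsp_of_mem_closure ha0 hmem⟩

/-- **If RH fails there is a LAST good window, and it lies at or beyond `1/4`.**  The set `G` of windows
carrying a one-signed ground state of the full windowed Weil form contains `(0, 1/4]` (small-window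
Perron–Frobenius, RH-free), is bounded if RH fails (floor + detector), and is closed in `(0, ∞)`; hence
`a⋆ = sup G` is a good window `≥ 1/4` beyond which every window is bad.  Perron–Frobenius, if it ever
dies, dies by touchdown at a finite height and never recovers. [folklore] -/
theorem exists_lastGoodWindow_of_not_riemannHypothesis (hRH : ¬ RiemannHypothesis) :
    ∃ aStar : ℝ, 1 / 4 ≤ aStar ∧
      (∃ u : ℝ → ℂ, IsWeilGroundState aStar u ∧
        ∀ᵐ t : ℝ, t ∈ Ioo (-aStar) aStar → (u t).im = 0 ∧ 0 ≤ (u t).re) ∧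
      ∀ a : ℝ, aStar < a → ∀ u : ℝ → ℂ, IsWeilGroundState a u →
        ¬ (∀ᵐ t : ℝ, t ∈ Ioo (-a) a → (u t).im = 0 ∧ 0 ≤ (u t).re) := by
  set Gset : Set ℝ := {a : ℝ | ∃ u : ℝ → ℂ, IsWeilGroundState a u ∧
    ∀ᵐ t : ℝ, t ∈ Ioo (-a) a → (u t).im = 0 ∧ 0 ≤ (u t).re} with hGset
  -- `1/4 ∈ G`
  have hquarter : (1 / 4 : ℝ) ∈ Gset := by
    obtain ⟨u, hu, hsign⟩ := swe_exists_nonneg_isWeilGroundState (a := 1 / 4) (by norm_num) le_rfl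
    exact ⟨u, hu, hsign.mono fun t ht _ ↦ ht⟩
  -- `G` is bounded above off RH
  obtain ⟨A, hA⟩ := eventually_atTop.1 (eventually_not_oneSigned_of_not_riemannHypothesis hRH)
  have hbdd : BddAbove Gset := by
    refine ⟨A, fun a ha ↦ ?_⟩
    by_contra hlt
    obtain ⟨u, hu, hsign⟩ := ha
    exact hA a (not_le.1 hlt).le u hu hsign
  have hne : Gset.Nonempty := ⟨_, hquarter⟩
  refine ⟨sSup Gset, le_csSup hbdd hquarter, ?_, fun a ha u hu hsign ↦ ?_⟩
  · -- `sup G ∈ G` (closedness)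
    have hpos : 0 < sSup Gset := lt_of_lt_of_le (by norm_num) (le_csSup hbdd hquarter)
    exact gsp_of_mem_closure hpos (csSup_mem_closure hne hbdd)
  · exact (not_le.2 ha) (le_csSup hbdd ⟨u, hu, hsign⟩)

/-- **The dichotomy**: either the Riemann Hypothesis holds, or Perron–Frobenius for the windowed Weil form
has a last good window `a⋆ ≥ 1/4` (good at `a⋆`, bad at every larger window). [folklore] -/
theorem riemannHypothesis_or_lastGoodWindow :
    RiemannHypothesis ∨ ∃ aStar : ℝ, 1 / 4 ≤ aStar ∧
      (∃ u : ℝ → ℂ, IsWeilGroundState aStar u ∧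
        ∀ᵐ t : ℝ, t ∈ Ioo (-aStar) aStar → (u t).im = 0 ∧ 0 ≤ (u t).re) ∧
      ∀ a : ℝ, aStar < a → ∀ u : ℝ → ℂ, IsWeilGroundState a u →
        ¬ (∀ᵐ t : ℝ, t ∈ Ioo (-a) a → (u t).im = 0 ∧ 0 ≤ (u t).re) := by
  by_cases hRH : RiemannHypothesis
  · exact Or.inl hRH
  · exact Or.inr (exists_lastGoodWindow_of_not_riemannHypothesis hRH)

end Summit.RiemannHypothesis.RiemannHypothesis.Theorems.PolarPerronFrobenius

end
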